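import Summits.CriticalPhenomena.PercolationContinuityZ3.Theorems.PercAnnulusCrossingOSSSCritical
import HarnessLib

/-!
# RSW3 lane (lead, gen 19): OSSS FOR CROSSINGS, VI — the annulus window in every dimension: across a band the level of
# `u_p(n,N) = P_p(Λ(n) ↔ ∂ⁱⁿΛ(N))` moves at rate `≥ (N−n)λ(1−λ)/S_{N−n}`, and at `p_c(ℤ^d)` (Kesten's floor `u ≥ 85^{−d}`) the subcritical
# finite-size thresholds of the aspect-2 annulus lie within `S_L(p_c)·(u_{p_c}(L) − λ)/(L·μ(1−μ))` of `p_c`, at EVERY scale, in EVERY `d ≥ 2`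

builds on p205010 (kernel theorem, internal audit signed; external expert review pending) — NOT used in this file.

Cell `prim-rsw3` (LANE 3), lead seat, gen 19.  Support file (`--supports stmt-CriticalPhenomena-4575`); no definitions, no named facts, no sorries.
Gen 18's recommendation (5)(ii) asked for the annulus analogue of the subcritical window bound ('the part of its band below p_c is ≤ 16/(λ(1−λ)|log 2π|)
wide — unconditional, every d'); here it is in the band-condition-free OSSS currency of part I (`exists_hasDerivAt_real_boxCrossing_ge_osss'`).

* **`annulus_mul_sub_le_sub_osss`** — every `d ≥ 1`, `n ≤ N`, `0 < p ≤ q < 1`: if `λ ≤ u_p(n,N)` and `u_q(n,N) ≤ 1 − λ` then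
  `(N−n)·λ(1−λ)·(q − p) ≤ S_{N−n}(q)·(u_q(n,N) − u_p(n,N))` (mean value inequality; `S` monotone in `q`).
* **`criticalProbI_sub_annulus_level_mul_le_osss`** — every `d ≥ 2`, `L ≥ 1`, every `0 < p ≤ p_c` and `μ` with `μ ≤ u_p(L,2L)` and
  `u_{p_c}(L,2L) ≤ 1 − μ`: `(p_c − p)·L·μ(1−μ) ≤ S_L(p_c)·(u_{p_c}(L,2L) − u_p(L,2L))` — UNCONDITIONAL, every scale: a parameter at which the aspect-2
  annulus is crossed with probability `λ` lies within `S_L(p_c)(U − λ)/(L·μ(1−μ))` below `p_c`, `U = u_{p_c}(L,2L) ∈ [85^{−d}, 1]`, `μ = min(λ, 1 − U)`.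
* **`criticalProbI_sub_annulus_level_le_of_critAnnulusNonCrossing_osss`** — `ℤ³` under X_B (`U ≤ 1 − c_X`): for every `λ ∈ (0, c_X]`, every
  `L ≥ 1` and every `p ≤ p_c` with `u_p(L,2L) = λ`: `(p_c − p)·L·λ(1−λ) ≤ S_L(p_c)` — the subcritical annulus thresholds approach `p_c` at least as fast as
  the Cesàro mean `S_L(p_c)/L` of the critical one-arm probabilities.

References: Duminil-Copin–Raoufi–Tassion (2019) §3; Kesten (1982) Thm 5.1; Friedgut–Kalai (1996); Chayes–Chayes–Fisher–Spencer (1986).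
-/

noncomputable section

namespace Summit.CriticalPhenomena.PercolationContinuityZ3.Theorems.Crossing

open MeasureTheory Filter Topology Finset
open Literature.Probability.Percolation Literature.Probability.LatticeModels
open Summit.CriticalPhenomena.PercolationContinuityZ3.Theorems.SurfaceTension

variable {d : ℕ}

/-- **THE ANNULUS WINDOW, INTEGRATED** (every `d ≥ 1`, `n ≤ N`, `0 < p ≤ q < 1`, every real `λ`): if `λ ≤ u_p(n,N)` and `u_q(n,N) ≤ 1 − λ` then
**`(N − n)·λ(1−λ)·(q − p) ≤ S_{N−n}(q)·(u_q(n,N) − u_p(n,N))`** — the mean value inequality for `r ↦ S_{N−n}(q)·u_r` on `[p,q]` with part I's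
`(N−n)u(1−u) ≤ S_{N−n}(r)·u′ ≤ S_{N−n}(q)·u′`. [cite: DuminilCopinRaoufiTassion2019, §3 proof of Thm 1.2 (integration of (3.4))] [cite: FriedgutKalai1996, Thm. 1.1] -/
theorem annulus_mul_sub_le_sub_osss (hd : 1 ≤ d) {n N : ℕ} (hnN : n ≤ N) {p q : unitInterval} (hp0 : 0 < (p : ℝ)) (hq1 : (q : ℝ) < 1)
    (hpq : p ≤ q) {lam : ℝ} (hlamp : lam ≤ (bondPercolation (zdGraph d) p).real (boxCrossing d n N))
    (hlamq : (bondPercolation (zdGraph d) q).real (boxCrossing d n N) ≤ 1 - lam) :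
    ((N - n : ℕ) : ℝ) * (lam * (1 - lam)) * ((q : ℝ) - p)
      ≤ (∑ j ∈ Finset.range (N - n), oneArmProb d q j)
        * ((bondPercolation (zdGraph d) q).real (boxCrossing d n N) - (bondPercolation (zdGraph d) p).real (boxCrossing d n N)) := by
  set S : ℝ := ∑ j ∈ Finset.range (N - n), oneArmProb d q j with hSdef
  have hS0 : 0 ≤ S := Finset.sum_nonneg fun _ _ => measureReal_nonneg
  set u : unitInterval → ℝ := fun r => (bondPercolation (zdGraph d) r).real (boxCrossing d n N) with hudef
  set f : ℝ → ℝ := fun r => S * (bondPercolation (zdGraph d) (Set.projIcc (0 : ℝ) 1 zero_le_one r)).real (boxCrossing d n N) with hfdef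
  have hfp : f p = S * u p := by simp only [hfdef, hudef, Set.projIcc_val zero_le_one p]
  have hfq : f q = S * u q := by simp only [hfdef, hudef, Set.projIcc_val zero_le_one q]
  have hcont : Continuous f := continuous_const.mul ((continuous_real_boxCrossing n N).comp continuous_projIcc)
  have hmono : ∀ {a b : unitInterval}, a ≤ b → u a ≤ u b := fun hab =>
    DCT16.real_mono_of_isUpperSet (zdGraph d) (isUpperSet_boxCrossing n N) (measurableSet_boxCrossing n N) hab
  have hderiv : ∀ x ∈ interior (Set.Icc (p : ℝ) q), ∃ D : ℝ, HasDerivAt f D x ∧ ((N - n : ℕ) : ℝ) * (lam * (1 - lam)) ≤ D := by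
    intro x hx
    rw [interior_Icc] at hx
    have hx0 : 0 < x := hp0.trans hx.1
    have hx1 : x < 1 := hx.2.trans hq1
    set r : unitInterval := ⟨x, hx0.le, hx1.le⟩ with hrdef
    have hpr : p ≤ r := Subtype.coe_le_coe.1 hx.1.le
    have hrq : r ≤ q := Subtype.coe_le_coe.1 hx.2.le
    obtain ⟨D, hD, hD0, hge⟩ := exists_hasDerivAt_real_boxCrossing_ge_osss' hd hnN (p := x) ⟨hx0, hx1⟩
    have hprojr : Set.projIcc (0 : ℝ) 1 zero_le_one x = r := by rw [hrdef]; exact Set.projIcc_of_mem _ ⟨hx0.le, hx1.le⟩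
    rw [hprojr] at hge
    have hvv : lam * (1 - lam) ≤ u r * (1 - u r) := mul_one_sub_le_mul_one_sub (hlamp.trans (hmono hpr)) ((hmono hrq).trans hlamq)
    have hSr : ∑ j ∈ Finset.range (N - n), oneArmProb d r j ≤ S := sum_oneArmProb_mono hrq
    refine ⟨S * D, hD.const_mul S, ?_⟩
    calc ((N - n : ℕ) : ℝ) * (lam * (1 - lam)) ≤ ((N - n : ℕ) : ℝ) * (u r * (1 - u r)) := mul_le_mul_of_nonneg_left hvv (by positivity)
      _ ≤ (∑ j ∈ Finset.range (N - n), oneArmProb d r j) * D := hge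
      _ ≤ S * D := mul_le_mul_of_nonneg_right hSr hD0
  have hdiff : DifferentiableOn ℝ f (interior (Set.Icc (p : ℝ) q)) := fun x hx => by
    obtain ⟨D, hD, -⟩ := hderiv x hx
    exact hD.differentiableAt.differentiableWithinAt
  have hge : ∀ x ∈ interior (Set.Icc (p : ℝ) q), ((N - n : ℕ) : ℝ) * (lam * (1 - lam)) ≤ deriv f x := fun x hx => by
    obtain ⟨D, hD, hDge⟩ := hderiv x hx
    rw [hD.deriv]; exact hDge
  have hmv := Convex.mul_sub_le_image_sub_of_le_deriv (convex_Icc (p : ℝ) q) hcont.continuousOn hdiff hge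
    (p : ℝ) (Set.left_mem_Icc.2 (Subtype.coe_le_coe.2 hpq)) (q : ℝ) (Set.right_mem_Icc.2 (Subtype.coe_le_coe.2 hpq))
    (Subtype.coe_le_coe.2 hpq)
  rw [hfp, hfq, ← mul_sub] at hmv
  exact hmv

/-- **THE SUBCRITICAL THRESHOLDS OF THE ASPECT-2 ANNULUS ARE CLOSE TO `p_c`, UNCONDITIONALLY, IN EVERY `d ≥ 2`, AT EVERY SCALE**: for `L ≥ 1`,
`0 < p ≤ p_c` and `μ` with `μ ≤ u_p(L,2L)` and `U := u_{p_c}(L,2L) ≤ 1 − μ`: **`(p_c − p)·L·μ(1−μ) ≤ S_L(p_c)·(U − u_p(L,2L))`** — with Kesten's floor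
`U ≥ 85^{−d}` every level `λ < 85^{−d}` is reached below `p_c`, and the level-`λ` parameter lies within `S_L(p_c)(U − λ)/(L·μ(1−μ))` of `p_c`,
`μ = min(λ, 1 − U)` (gen 18's log form needed the band condition). [cite: Kesten1982, Thm. 5.1] [cite: DuminilCopinRaoufiTassion2019, §3 eq. (3.4)] -/
theorem criticalProbI_sub_annulus_level_mul_le_osss (hd : 2 ≤ d) {L : ℕ} (hL : 1 ≤ L) {p : unitInterval} (hp0 : 0 < (p : ℝ))
    (hpc : p ≤ criticalProbI d) {μ : ℝ} (hμp : μ ≤ (bondPercolation (zdGraph d) p).real (boxCrossing d L (2 * L)))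
    (hμc : (bondPercolation (zdGraph d) (criticalProbI d)).real (boxCrossing d L (2 * L)) ≤ 1 - μ) :
    ((criticalProbI d : ℝ) - p) * ((L : ℝ) * (μ * (1 - μ)))
      ≤ (∑ j ∈ Finset.range L, oneArmProb d (criticalProbI d) j)
        * ((bondPercolation (zdGraph d) (criticalProbI d)).real (boxCrossing d L (2 * L))
          - (bondPercolation (zdGraph d) p).real (boxCrossing d L (2 * L))) := by
  have hpc1 : (criticalProbI d : ℝ) < 1 := by rw [coe_criticalProbI]; exact criticalProb_zd_lt_one hd
  have h := annulus_mul_sub_le_sub_osss (d := d) (by omega) (show L ≤ 2 * L by omega) hp0 hpc1 hpc (lam := μ) hμp hμc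
  rw [show 2 * L - L = L by omega] at h
  calc ((criticalProbI d : ℝ) - p) * ((L : ℝ) * (μ * (1 - μ))) = (L : ℝ) * (μ * (1 - μ)) * ((criticalProbI d : ℝ) - p) := by ring
    _ ≤ _ := h

/-- **UNDER X_B THE SUBCRITICAL ANNULUS THRESHOLDS APPROACH `p_c(ℤ³)` AT RATE `S_L(p_c)/L`** (every scale, no p205010): if `CritAnnulusNonCrossing`
(`u_{p_c}(L,2L) ≤ 1 − c_X` for `L ≥ 1`), then for every `λ ∈ (0, c_X]`, every `L ≥ 1` and every `p ≤ p_c` at which the annulus is crossed with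
probability exactly `λ`: **`(p_c − p)·L·λ(1−λ) ≤ S_L(p_c)`**. [cite: Kesten1982, Thm. 5.1] [cite: FriedgutKalai1996, Thm. 1.1] -/
theorem criticalProbI_sub_annulus_level_le_of_critAnnulusNonCrossing_osss
    (hX : Summit.CriticalPhenomena.PercolationContinuityZ3.Theses.PercAnnulusCrossing.CritAnnulusNonCrossing) :
    ∃ c : ℝ, 0 < c ∧ ∀ lam : ℝ, 0 < lam → lam ≤ c → ∀ L : ℕ, 1 ≤ L → ∀ p : unitInterval, 0 < (p : ℝ) → p ≤ criticalProbI 3 →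
      (bondPercolation (zdGraph 3) p).real (boxCrossing 3 L (2 * L)) = lam →
      ((criticalProbI 3 : ℝ) - p) * ((L : ℝ) * (lam * (1 - lam))) ≤ ∑ j ∈ Finset.range L, oneArmProb 3 (criticalProbI 3) j := by
  obtain ⟨cX, hcX, hX'⟩ := critAnnulusNonCrossing_iff.1 hX
  refine ⟨cX, hcX, fun lam hlam0 hlamc L hL p hp0 hpc hlev => ?_⟩
  have hU : (bondPercolation (zdGraph 3) (criticalProbI 3)).real (boxCrossing 3 L (2 * L)) ≤ 1 - cX :=
    (measureReal_mono (Rsw3.boxCrossing_subset_annulusCrossing (d := 3) L) (measure_ne_top _ _)).trans (hX' L hL)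
  have h := criticalProbI_sub_annulus_level_mul_le_osss (d := 3) (by norm_num) hL hp0 hpc (μ := lam) hlev.ge (by linarith)
  have hS0 : 0 ≤ ∑ j ∈ Finset.range L, oneArmProb 3 (criticalProbI 3) j := Finset.sum_nonneg fun _ _ => measureReal_nonneg
  have hdiff : (bondPercolation (zdGraph 3) (criticalProbI 3)).real (boxCrossing 3 L (2 * L))
      - (bondPercolation (zdGraph 3) p).real (boxCrossing 3 L (2 * L)) ≤ 1 := by
    linarith [measureReal_le_one (μ := bondPercolation (zdGraph 3) (criticalProbI 3)) (s := boxCrossing 3 L (2 * L)),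
      measureReal_nonneg (μ := bondPercolation (zdGraph 3) p) (s := boxCrossing 3 L (2 * L))]
  calc ((criticalProbI 3 : ℝ) - p) * ((L : ℝ) * (lam * (1 - lam))) ≤ _ := h
    _ ≤ (∑ j ∈ Finset.range L, oneArmProb 3 (criticalProbI 3) j) * 1 := mul_le_mul_of_nonneg_left hdiff hS0
    _ = _ := mul_one _

end Summit.CriticalPhenomena.PercolationContinuityZ3.Theorems.Crossing

end
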